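import Literature.IUT.HodgeArakelov.AbsTopMonoidsGenuine
import HarnessLib

/-!
# [IUTchII] Example 1.8: the GENUINE-mod-`ε` `AbsTopMonoids` as a DEFINITION (MERGE-MAP row B9, O^⊳ side, def level)

S. Mochizuki, *Inter-universal Teichmüller theory II*, §1, Example 1.8 (i)–(iv), kurims pp. 35–39
[claim: Mochizuki2012, status: disputed] (IUTchII §1 Ex 1.8, kurims pp.35-39).  abc-iut cell, row «D-B9-genuine»
(abc-iut-L6-lead §F v1.19b (3): the def-level sequel of the proof-only witness
`AbsTopMonoids.nonempty_genuine_of_modelIdentification`, p420930, for consumers that must COMPUTE with the genuine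
monoids — e.g. abc-iut-w4-d030's `GalRigidityInput`, whose `bsGalTri : μ_Ẑ(G) ≃* Λ(O^×(G))` needs `O^⊳(G) = 𝒪_k̄^⊳`
definitionally).  Seat abc-iut-L6-t13 (gen 4).  SAME TERM as p420930, now with names:

* `Genuine.theta ε G : G ≃ₜ* Gal(k̄/k)` — the chosen identification of an isomorph `G` of `G_k` (choice + `ε`);
* `Genuine.liftM C φ` — THE lift of `φ ∈ Aut_top(Gal(k̄/k))` to `𝒪_k̄^⊳` (`MLFClosure.existsUnique_tmPairLift`), with
  `liftM_spec` (equivariance), `liftM_unique`, `liftM_refl`, `liftM_trans`;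
* `Genuine.qObj`, `Genuine.qMap` — the quotient objects `Π*/Δ*` and the induced isomorphisms of quotients;
* `AbsTopMonoids.genuineOfModel S C ε hΔ hq : AbsTopMonoids S` and the `rfl` lemmas `genuineOfModel_Otri`
  (`= 𝒪_k̄^⊳`), `genuineOfModel_MTM`, `genuineOfModel_actOtri_apply`, `genuineOfModel_mapOtri`.

GENUINE: `O^⊳`, `M_TM`, all actions and transports (mod `ε` and chosen isomorphisms).  DEGENERATE (honest residual,
B9 (d)): `Ism := PUnit`, `actIsm`, `toIsm` trivial — the genuine isometry group and `Ẑ^× ↠ ℤ_p^× ↪ Ism` need the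
`ℤ_p`-module structure of `𝒪_k̄^×/μ`.  Nothing here bears on [IUTchIII] Cor. 3.12; classical construction.
-/

noncomputable section

namespace Literature.IUT.HodgeArakelov

open CategoryTheory
open Literature.AnabelianGeometry.AbsoluteAnabelian

namespace AbsTopMonoids

namespace Genuine

variable {S : ThetaSetting.{0}} (C : MLFClosure.{0})

/-- The chosen identification `G ≅ Gal(k̄/k)` of an isomorph `G` of `G_k`: a chosen `G ≅ G_k` (the groupoid
`IsoClass G_k` records only `Nonempty (G ≅ G_k)`) followed by the model identification `ε`.
[claim: Mochizuki2012, status: disputed] (IUTchII §1 Ex 1.8 (i), kurims p.35) -/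
def theta (ε : S.Gk ≃ₜ* (ModelMLFGaloisData.galois C.k C.K).tmPair.Pi) (G : IsoClass S.Gk) :
    G.G ≃ₜ* (ModelMLFGaloisData.galois C.k C.K).tmPair.Pi :=
  (Classical.choice G.iso).trans ε

/-- **THE lift** of a topological automorphism `φ` of `Gal(k̄/k)` to the model `TM`-pair `(Gal(k̄/k) ↷ 𝒪_k̄^⊳)`
(`MLFClosure.existsUnique_tmPairLift`: F-0410 + injectivity). [cite: MochizukiAbsTopIII2015, Proposition 3.2 (iv) p.72] -/
def liftM (φ : (ModelMLFGaloisData.galois C.k C.K).tmPair.Pi ≃ₜ* (ModelMLFGaloisData.galois C.k C.K).tmPair.Pi) :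
    (ModelMLFGaloisData.galois C.k C.K).tmPair.M ≃* (ModelMLFGaloisData.galois C.k C.K).tmPair.M :=
  (MLFClosure.existsUnique_tmPairLift C C φ).exists.choose

/-- The lift is `φ`-equivariant. [cite: MochizukiAbsTopIII2015, Proposition 3.2 (iv) p.72] -/
theorem liftM_spec (φ : (ModelMLFGaloisData.galois C.k C.K).tmPair.Pi ≃ₜ* (ModelMLFGaloisData.galois C.k C.K).tmPair.Pi)
    (σ : (ModelMLFGaloisData.galois C.k C.K).tmPair.Pi) (x : (ModelMLFGaloisData.galois C.k C.K).tmPair.M) :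
    liftM C φ (σ • x) = φ σ • liftM C φ x :=
  (MLFClosure.existsUnique_tmPairLift C C φ).exists.choose_spec σ x

/-- The lift is the UNIQUE `φ`-equivariant automorphism of `𝒪_k̄^⊳`. [cite: MochizukiAbsTopIII2015, Proposition 3.2 (iv) p.72] -/
theorem liftM_unique (φ : (ModelMLFGaloisData.galois C.k C.K).tmPair.Pi ≃ₜ* (ModelMLFGaloisData.galois C.k C.K).tmPair.Pi)
    (ψ : (ModelMLFGaloisData.galois C.k C.K).tmPair.M ≃* (ModelMLFGaloisData.galois C.k C.K).tmPair.M)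
    (hψ : ∀ (σ : (ModelMLFGaloisData.galois C.k C.K).tmPair.Pi) (x : (ModelMLFGaloisData.galois C.k C.K).tmPair.M),
      ψ (σ • x) = φ σ • ψ x) : ψ = liftM C φ :=
  (MLFClosure.existsUnique_tmPairLift C C φ).unique hψ (liftM_spec C φ)

/-- The lift depends only on the underlying function of `φ`. [cite: MochizukiAbsTopIII2015, Proposition 3.2 (iv) p.72] -/
theorem liftM_congr {φ φ' : (ModelMLFGaloisData.galois C.k C.K).tmPair.Pi ≃ₜ* (ModelMLFGaloisData.galois C.k C.K).tmPair.Pi}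
    (h : ∀ σ, φ σ = φ' σ) : liftM C φ = liftM C φ' :=
  liftM_unique C φ' _ fun σ x => by rw [liftM_spec, h]

/-- The lift of (a map acting as) the identity is the identity. [cite: Mochizuki2012, IUTchII Ex 1.8 (ii) p.36] -/
theorem liftM_refl {φ : (ModelMLFGaloisData.galois C.k C.K).tmPair.Pi ≃ₜ* (ModelMLFGaloisData.galois C.k C.K).tmPair.Pi}
    (h : ∀ σ, φ σ = σ) : liftM C φ = MulEquiv.refl _ :=
  (liftM_unique C φ _ fun σ x => by rw [h]; rfl).symm

/-- The lift of a composite is the composite of the lifts. [cite: Mochizuki2012, IUTchII Ex 1.8 (iii) p.38] -/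
theorem liftM_trans {φ₁ φ₂ φ : (ModelMLFGaloisData.galois C.k C.K).tmPair.Pi ≃ₜ* (ModelMLFGaloisData.galois C.k C.K).tmPair.Pi}
    (h : ∀ σ, φ σ = φ₂ (φ₁ σ)) : liftM C φ = (liftM C φ₁).trans (liftM C φ₂) :=
  (liftM_unique C φ _ fun σ x => by
    rw [MulEquiv.trans_apply, liftM_spec, liftM_spec, MulEquiv.trans_apply, h]).symm

/-- The automorphism of `Gal(k̄/k)` induced (through `theta`) by a morphism `f : G ⟶ H` of `IsoClass G_k`.
[claim: Mochizuki2012, status: disputed] (IUTchII §1 Ex 1.8 (iii), kurims p.38) -/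
def phiOf (ε : S.Gk ≃ₜ* (ModelMLFGaloisData.galois C.k C.K).tmPair.Pi) {G H : IsoClass S.Gk} (f : G ⟶ H) :
    (ModelMLFGaloisData.galois C.k C.K).tmPair.Pi ≃ₜ* (ModelMLFGaloisData.galois C.k C.K).tmPair.Pi :=
  ((theta C ε G).symm.trans (IsoClass.homIso f)).trans (theta C ε H)

/-- `phiOf` applied. [claim: Mochizuki2012, status: disputed] (IUTchII §1 Ex 1.8 (iii), kurims p.38) -/
@[simp] theorem phiOf_apply (ε : S.Gk ≃ₜ* (ModelMLFGaloisData.galois C.k C.K).tmPair.Pi) {G H : IsoClass S.Gk}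
    (f : G ⟶ H) (σ : (ModelMLFGaloisData.galois C.k C.K).tmPair.Pi) :
    phiOf C ε f σ = theta C ε H (IsoClass.homIso f ((theta C ε G).symm σ)) := rfl

variable (hΔ : ∀ f : S.PiX ≃ₜ* S.PiX, S.DeltaX.map f.toMulEquiv.toMonoidHom = S.DeltaX)
variable (hq : Nonempty (TopGroup.quot S.PiX S.DeltaX ≃ₜ* S.Gk))

/-- The quotient `Π*/Δ*` of an isomorph `Π*` of `Π^tp_{X̲̲_k}`, as an object of `IsoClass G_k` (via
abc-iut-w5-d114's `quotDeltaOfIso` and (H2)). [claim: Mochizuki2012, status: disputed] (IUTchII §1 Ex 1.8 (i), kurims p.36) -/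
def qObj (P : IsoClass S.PiX) : IsoClass S.Gk :=
  ⟨TopGroup.quot P.G (deltaOf P), ⟨(quotDeltaOfIso P).trans (Classical.choice hq)⟩⟩

/-- The isomorphism of quotients `Π*/Δ* ⥲ Π**/Δ**` induced by `f : Π* ⥲ Π**` (well defined by (H1):
abc-iut-w5-d114's `deltaOf_map`). [claim: Mochizuki2012, status: disputed] (IUTchII §1 Ex 1.8 (ii), kurims p.36) -/
def qMap {P Q : IsoClass S.PiX} (f : P ⟶ Q) : qObj hq P ⟶ qObj hq Q :=
  { toMulEquiv := QuotientGroup.congr (deltaOf P) (deltaOf Q) (IsoClass.homIso f).toMulEquiv (deltaOf_map hΔ f)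
    continuous_toFun := by
      refine (QuotientGroup.isQuotientMap_mk (deltaOf P)).continuous_iff.2 ?_
      exact QuotientGroup.continuous_mk.comp (IsoClass.homIso f).continuous
    continuous_invFun := by
      refine (QuotientGroup.isQuotientMap_mk (deltaOf Q)).continuous_iff.2 ?_
      exact QuotientGroup.continuous_mk.comp (IsoClass.homIso f).symm.continuous }

/-- `qMap f` on representatives. [claim: Mochizuki2012, status: disputed] (IUTchII §1 Ex 1.8 (ii), kurims p.36) -/
theorem qMap_mk {P Q : IsoClass S.PiX} (f : P ⟶ Q) (x : P.G) :
    IsoClass.homIso (qMap hΔ hq f) (QuotientGroup.mk x : TopGroup.quot P.G (deltaOf P)) =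
      (QuotientGroup.mk (IsoClass.homIso f x) : TopGroup.quot Q.G (deltaOf Q)) := rfl

end Genuine

open Genuine

variable (S : ThetaSetting.{0}) (C : MLFClosure.{0}) (ε : S.Gk ≃ₜ* (ModelMLFGaloisData.galois C.k C.K).tmPair.Pi)
  (hΔ : ∀ f : S.PiX ≃ₜ* S.PiX, S.DeltaX.map f.toMulEquiv.toMonoidHom = S.DeltaX)
  (hq : Nonempty (TopGroup.quot S.PiX S.DeltaX ≃ₜ* S.Gk))

/-- **The GENUINE-mod-`ε` `AbsTopMonoids S` as a definition** (same term as the proof-only witness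
`nonempty_genuine_of_modelIdentification`, p420930): `O^⊳(G) := 𝒪_k̄^⊳` with `G` acting through `theta`,
`O^⊳(f) :=` THE lift of the induced automorphism of `Gal(k̄/k)`, `M_TM(Π) := O^⊳(Π/Δ)` with `(*TM⊳) := id`;
`Ism` DEGENERATE (B9 (d) residual). [claim: Mochizuki2012, status: disputed] (IUTchII §1 Ex 1.8 (ii)-(iv), kurims pp.36-39) -/
def genuineOfModel : AbsTopMonoids S where
  Otri _ := (ModelMLFGaloisData.galois C.k C.K).tmPair.M
  actOtri G := (MulDistribMulAction.toMulAut (ModelMLFGaloisData.galois C.k C.K).tmPair.Pi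
    (ModelMLFGaloisData.galois C.k C.K).tmPair.M).comp (theta C ε G).toMulEquiv.toMonoidHom
  mapOtri f := liftM C (phiOf C ε f)
  mapOtri_id G := liftM_refl C fun σ => by
    rw [phiOf_apply]
    exact (theta C ε G).apply_symm_apply σ
  mapOtri_comp f g := liftM_trans C fun σ => by
    rw [phiOf_apply, phiOf_apply, phiOf_apply, ContinuousMulEquiv.symm_apply_apply]
    rfl
  mapOtri_equivariant {G H} f g m := by
    show liftM C (phiOf C ε f) (theta C ε G g • m) = theta C ε H (IsoClass.homIso f g) • liftM C (phiOf C ε f) m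
    rw [liftM_spec, phiOf_apply, ContinuousMulEquiv.symm_apply_apply]
  MTM _ := (ModelMLFGaloisData.galois C.k C.K).tmPair.M
  actMTM P := ((MulDistribMulAction.toMulAut (ModelMLFGaloisData.galois C.k C.K).tmPair.Pi
    (ModelMLFGaloisData.galois C.k C.K).tmPair.M).comp (theta C ε (qObj hq P)).toMulEquiv.toMonoidHom).comp
    (QuotientGroup.mk' (deltaOf P))
  mapMTM f := liftM C (phiOf C ε (qMap hΔ hq f))
  mapMTM_id P := liftM_refl C fun σ => by
    rw [phiOf_apply]
    have h : ∀ q : TopGroup.quot P.G (deltaOf P), IsoClass.homIso (qMap hΔ hq (𝟙 P)) q = q := by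
      intro q
      induction q using QuotientGroup.induction_on with
      | H x => rfl
    rw [h, ContinuousMulEquiv.apply_symm_apply]
  mapMTM_comp {P Q R} f g := liftM_trans C fun σ => by
    rw [phiOf_apply, phiOf_apply, phiOf_apply, ContinuousMulEquiv.symm_apply_apply]
    congr 1
    generalize (theta C ε (qObj hq P)).symm σ = q
    induction q using QuotientGroup.induction_on with
    | H x => rfl
  mapMTM_equivariant {P Q} f x m := by
    show liftM C (phiOf C ε (qMap hΔ hq f)) (theta C ε (qObj hq P) (QuotientGroup.mk x) • m) =
      theta C ε (qObj hq Q) (QuotientGroup.mk (IsoClass.homIso f x)) • liftM C (phiOf C ε (qMap hΔ hq f)) m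
    rw [liftM_spec, phiOf_apply, ContinuousMulEquiv.symm_apply_apply, qMap_mk]
  Delta P := deltaOf P
  Delta_map f := deltaOf_map hΔ f
  Delta_base := deltaOf_base hΔ
  quotIso P := (qObj hq P).iso
  tauto _ := MulEquiv.refl _
  tauto_equivariant _ _ _ := rfl
  Ism _ := PUnit
  actIsm _ := 1
  toIsm _ := 1

/-- `O^⊳(G)` of the genuine producer is `𝒪_k̄^⊳` (definitionally). [claim: Mochizuki2012, status: disputed] (IUTchII §1 Ex 1.8 (ii), kurims p.36) -/
@[simp] theorem genuineOfModel_Otri (G : IsoClass S.Gk) :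
    (genuineOfModel S C ε hΔ hq).Otri G = (ModelMLFGaloisData.galois C.k C.K).tmPair.M := rfl

/-- `M_TM(Π)` of the genuine producer is `𝒪_k̄^⊳` (definitionally). [claim: Mochizuki2012, status: disputed] (IUTchII §1 Ex 1.8 (ii), kurims p.36) -/
@[simp] theorem genuineOfModel_MTM (P : IsoClass S.PiX) :
    (genuineOfModel S C ε hΔ hq).MTM P = (ModelMLFGaloisData.galois C.k C.K).tmPair.M := rfl

/-- The action of `g ∈ G` on `O^⊳(G)` is the Galois action of `theta g`. [claim: Mochizuki2012, status: disputed] (IUTchII §1 Ex 1.8 (ii), kurims p.36) -/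
theorem genuineOfModel_actOtri_apply (G : IsoClass S.Gk) (g : G.G) (m : (ModelMLFGaloisData.galois C.k C.K).tmPair.M) :
    (genuineOfModel S C ε hΔ hq).actOtri G g m = theta C ε G g • m := rfl

/-- The transport `O^⊳(f)` is THE lift of the induced automorphism of `Gal(k̄/k)`. [claim: Mochizuki2012, status: disputed] (IUTchII §1 Ex 1.8 (iii), kurims p.38) -/
theorem genuineOfModel_mapOtri {G H : IsoClass S.Gk} (f : G ⟶ H) :
    (genuineOfModel S C ε hΔ hq).mapOtri f = liftM C (phiOf C ε f) := rfl

/-- `Δ` of the genuine producer is abc-iut-w5-d114's transported `deltaOf`. [claim: Mochizuki2012, status: disputed] (IUTchII §1 Ex 1.8 (i), kurims p.35) -/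
theorem genuineOfModel_Delta (P : IsoClass S.PiX) : (genuineOfModel S C ε hΔ hq).Delta P = deltaOf P := rfl

end AbsTopMonoids

end Literature.IUT.HodgeArakelov

end
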